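import Mathlib
import HarnessLib

/-!
# One kernel for all conditionings, from a countable π-system (soft-Markov brick SM6')

Crux `AxiomsOfLimit` (stmt-CriticalPhenomena-1370), line `registered`, stub `stub_markovOfLimit`,
soft-Markov brick SM6' "one kernel for all conditionings, from a countable π-system" (lead c4).
Theorems only.

Setting: `Ω` standard Borel, `μ` a finite measure on `Ω`, `A : ℕ → Set Ω` a countable family of
measurable sets whose range is a π-system generating the σ-algebra of `Ω`, and `Z : ℕ → E → ℝ`
arbitrary functions on a measurable space `E`.

* `measure_eq_of_toReal_apply_eq` — π-system uniqueness: two probability measures on `Ω` whose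
  real-valued masses agree on every `A k` are equal (`MeasureTheory.ext_of_generate_finite`).
* `exists_forall_condDistrib_apply_ae_eq` — the kernel assembly (general universes): there is ONE
  map `K : E → Measure Ω`, built from the `Z k` alone (`K e :=` some probability measure with
  masses `Z k e` on the `A k` if one exists, `μ` otherwise), such that for EVERY measurable
  `X : Ω → E` whose conditional probabilities `μ⟦A k | σ(X)⟧` admit the versions `Z k ∘ X`, the
  regular conditional distribution `condDistrib id X μ` evaluated at `X ω` equals `K (X ω)` for
  `μ`-a.e. `ω`: by `ProbabilityTheory.condDistrib_ae_eq_condExp` and `ae_all_iff`, a.e. the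
  probability measure `condDistrib id X μ (X ω)` has masses `Z k (X ω)` on all `A k`, so it
  witnesses the existential defining `K (X ω)` and coincides with the chosen witness by uniqueness.
* `stub_kernelFromCountableFamily` — the registered signature (the hypotheses `Set.univ ∈ range A`
  and measurability of the `Z k` are not needed).

Folklore (regular conditional distributions and π-λ uniqueness; e.g. O. Kallenberg, Foundations of
Modern Probability, Thm. 6.3 and Lemma 1.17). All `[folklore]`.
-/

noncomputable section

open MeasureTheory ProbabilityTheory Filter Set
open scoped ENNReal

namespace Summit.CriticalPhenomena.SAWScalingLimit.Theorems.AxiomsOfLimitMarkov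

/-- π-system uniqueness: two probability measures whose real masses agree on every member `A k` of
a countable π-system generating the σ-algebra are equal. [folklore] -/
theorem measure_eq_of_toReal_apply_eq {Ω : Type*} [mΩ : MeasurableSpace Ω] {A : ℕ → Set Ω}
    (hpi : IsPiSystem (Set.range A)) (hgen : mΩ = MeasurableSpace.generateFrom (Set.range A))
    (ν ν' : Measure Ω) [IsProbabilityMeasure ν] [IsProbabilityMeasure ν']
    (h : ∀ k, (ν (A k)).toReal = (ν' (A k)).toReal) : ν = ν' := by
  refine ext_of_generate_finite (Set.range A) hgen hpi ?_ (by simp [measure_univ])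
  rintro _ ⟨k, rfl⟩
  exact (ENNReal.toReal_eq_toReal_iff' (measure_ne_top _ _) (measure_ne_top _ _)).mp (h k)

/-- Kernel assembly from a countable π-system (general universes): if the conditional
probabilities of the sets `A k` of a countable generating π-system, given `σ(X)`, admit versions
`Z k ∘ X` with `Z k` not depending on `X`, then one map `K : E → Measure Ω`, defined from the `Z k`
alone, agrees with the regular conditional distribution `condDistrib id X μ` at `X ω` for a.e. `ω`,
simultaneously for every such measurable `X`. [folklore] -/
theorem exists_forall_condDistrib_apply_ae_eq {Ω : Type*} [mΩ : MeasurableSpace Ω]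
    [StandardBorelSpace Ω] [Nonempty Ω] (μ : Measure Ω) [IsFiniteMeasure μ] {E : Type*}
    [mE : MeasurableSpace E] {A : ℕ → Set Ω} (hA : ∀ k, MeasurableSet (A k))
    (hpi : IsPiSystem (Set.range A)) (hgen : mΩ = MeasurableSpace.generateFrom (Set.range A))
    (Z : ℕ → E → ℝ) :
    ∃ K : E → Measure Ω, ∀ (X : Ω → E), Measurable X →
      (∀ k, μ[(A k).indicator (fun _ => (1 : ℝ)) | mE.comap X] =ᵐ[μ] fun ω => Z k (X ω)) →
      ∀ᵐ ω ∂μ, condDistrib id X μ (X ω) = K (X ω) := by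
  classical
  refine ⟨fun e => if h : ∃ ν : Measure Ω, IsProbabilityMeasure ν ∧ ∀ k, (ν (A k)).toReal = Z k e
    then h.choose else μ, fun X hX hZ => ?_⟩
  have hae : ∀ᵐ ω ∂μ, ∀ k, ((condDistrib id X μ (X ω)) (A k)).toReal = Z k (X ω) := by
    rw [ae_all_iff]
    intro k
    have h1 := condDistrib_ae_eq_condExp (μ := μ) hX measurable_id (hA k)
    filter_upwards [h1, hZ k] with ω h1ω h2ω
    rw [← measureReal_def, h1ω]
    exact h2ω
  filter_upwards [hae] with ω hω
  have hex : ∃ ν : Measure Ω, IsProbabilityMeasure ν ∧ ∀ k, (ν (A k)).toReal = Z k (X ω) :=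
    ⟨condDistrib id X μ (X ω), inferInstance, hω⟩
  rw [dif_pos hex]
  obtain ⟨hprob, hvals⟩ := hex.choose_spec
  exact measure_eq_of_toReal_apply_eq hpi hgen _ _ fun k => (hω k).trans (hvals k).symm

/-- Registered signature, soft-Markov brick SM6': one kernel-like map `K : E → Measure Ω`, built
from the `Z k` alone, represents `condDistrib id X μ` at `X ω` for a.e. `ω`, simultaneously for every
measurable `X : Ω → E` whose conditional probabilities of the `A k` given `σ(X)` have the versions
`Z k ∘ X` (the hypotheses `Set.univ ∈ Set.range A` and measurability of the `Z k` are not used).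
[folklore] -/
theorem stub_kernelFromCountableFamily : ∀ (Ω : Type) [mΩ : MeasurableSpace Ω] [StandardBorelSpace Ω] [Nonempty Ω] (μ : MeasureTheory.Measure Ω) [MeasureTheory.IsFiniteMeasure μ] (E : Type) [MeasurableSpace E] (A : ℕ → Set Ω), (∀ k, MeasurableSet (A k)) → IsPiSystem (Set.range A) → mΩ = MeasurableSpace.generateFrom (Set.range A) → Set.univ ∈ Set.range A → ∀ (Z : ℕ → E → ℝ), (∀ k, Measurable (Z k)) → ∃ K : E → MeasureTheory.Measure Ω, ∀ (X : Ω → E), Measurable X → (∀ k, MeasureTheory.condExp (MeasurableSpace.comap X inferInstance) μ ((A k).indicator (fun _ => (1 : ℝ))) =ᵐ[μ] fun ω => Z k (X ω)) → Filter.Eventually (fun ω => (ProbabilityTheory.condDistrib id X μ) (X ω) = K (X ω)) (MeasureTheory.ae μ) :=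
  fun _ _ _ _ μ _ _ _ _ hA hpi hgen _ Z _ => exists_forall_condDistrib_apply_ae_eq μ hA hpi hgen Z

end Summit.CriticalPhenomena.SAWScalingLimit.Theorems.AxiomsOfLimitMarkov

end
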